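import Summits.NavierStokesRegularity.NavierStokesRegularity.Theorems.OddMorawetzOrderThreeIndefiniteValue

/-!
# Route OddMorawetz / crux `OddMorawetzLocal` — the pairing of `B(v,v)` with a polynomial-Gaussian test field

Support file for item stmt-NavierStokesRegularity-1376 (refutation skeleton of `OddMorawetzLocal`, Layer G,
registered stub `pairing_value`).

The refutation needs EXACT values of Euler derivatives `Q_m(v) = -∫ Dm(Jv)[J B(v,v)]` of isotropic local
densities at explicit odd polynomial-Gaussian fields `v = pgv 1 P = P e^{-|x|²}`; after integration by parts
each is a pairing `∫ ⟪B(v,v), G⟫` with an explicit polynomial-Gaussian test field `G = pgv 2 Q = Q e^{-2|x|²}`.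
This file evaluates that pairing as an explicit real number, given the polynomial bookkeeping of the data:
even Hermite expansions (`pairs`, `hermVal`) of the two divergences `div W` (`W = 2(v·∇)v`, polynomial `rhoWP P`)
and `div G` (polynomial `∑ᵢ dg 2 i (Q i)`), and even monomial expansions (`polyE`) of `⟪W, G⟫ e^{4|x|²}` and of the
Fourier-side product `hermVal LW · hermVal LG`:

`∫ ⟪B(v,v), G⟫ = -½ [ ∫ ⟪W, G⟫ − (4π²)⁻¹ (π/2)³ ∫ hermVal_W hermVal_G e^{-π²|ξ|²}/|ξ|² dξ ]`

with both integrals replaced by their Gaussian / Riesz moments.  It is the tree's `orderThree_value`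
(`OddMorawetzOrderThreeIndefiniteValue.lean`) with the specific test field `GP P` replaced by a general `Q`;
the proof is the same chain: `integral_inner_eulerBilinear_eq` (`B(v,v) = -½ P W`), the Leray duality
`integral_inner_lerayProjFun_eq_sub` with the divergences `rho_eq (WP P)`, `rho_eq Q`, the Fourier side
`fourier_pgC_hermiteList`, `re_integral_fourier_pair`, and termwise moments `integral_polyE_mul`,
`integral_monomial_gauss_four_even`, `integral_monomial_gauss_div_normSq_pi`.
Everything is proved; no definitions; no named facts.
-/

noncomputable section

open MeasureTheory SchwartzMap MvPolynomial
open scoped RealInnerProductSpace LineDeriv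

-- the problem namespace `Summit.NavierStokesRegularity.NavierStokesRegularity` repeats the summit name by design (D-0017)
set_option linter.dupNamespace false

namespace Summit.NavierStokesRegularity.NavierStokesRegularity.Theorems.OddMorawetz

section PairingValue
open FourierTransform Complex Real Literature.Analysis Literature.Analysis.FluidPDE
open scoped ComplexConjugate

/-- `⟪pgv 2 P x, pgv 2 Q x⟫ = (∑ᵢ Pᵢ Qᵢ)(x) e^{-4|x|²}` pointwise: the inner product of two rate-`2`
polynomial-Gaussian fields is the rate-`4` polynomial Gaussian of `∑ᵢ Pᵢ Qᵢ`. -/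
theorem inner_pgv_two_pgv_two (P Q : Fin 3 → P3) (x : E3) :
    ⟪pgv 2 P x, pgv 2 Q x⟫ = pg 4 (∑ i, P i * Q i) x := by
  rw [PiLp.inner_apply, pg_sum]
  refine Finset.sum_congr rfl fun i _ => ?_
  rw [RCLike.inner_apply, conj_trivial, pgv_apply, pgv_apply, pg_mul, mul_comm]

/-- **The pairing of the Euler term of an explicit polynomial-Gaussian field with an explicit polynomial-Gaussian
test field, as an explicit number** (stub `pairing_value` of crux `OddMorawetzLocal`).  For `v = pgv 1 P` and
`G = pgv 2 Q`, given the even Hermite expansions `LW`, `LG` of `div W` (`W = 2(v·∇)v`) and `div G` and the even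
monomial expansions `Mloc` of `⟪W, G⟫ e^{4|x|²}` and `Mfour` of `hermVal LW · hermVal LG`,
`∫ ⟪B(v,v), G⟫ = -½ [ Σ_Mloc (Gaussian moments) − (4π²)⁻¹ (π/2)³ Σ_Mfour (Riesz–Gaussian moments) ]`. -/
theorem pairing_value (P Q : Fin 3 → P3) (LW LG : List (ℝ × List (Fin 3))) (Mloc Mfour : List (ℝ × ℕ × ℕ × ℕ))
    (hW : ∀ x, pev (rhoWP P) x = (LW.map fun dl => dl.1 * pev (dgList 2 (pairs dl.2) 1) x).sum)
    (hG : ∀ x, pev (∑ i, dg 2 i (Q i)) x = (LG.map fun dl => dl.1 * pev (dgList 2 (pairs dl.2) 1) x).sum)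
    (hloc : ∀ x, pev (∑ i, WP P i * Q i) x = polyE Mloc x)
    (hfour : ∀ ξ, hermVal LW ξ * hermVal LG ξ = polyE Mfour ξ) :
    ∫ x, ⟪Literature.Analysis.FluidPDE.eulerBilinear (pgv 1 P) (pgv 1 P) x, pgv 2 Q x⟫ =
      -2⁻¹ * ((Mloc.map fun t => t.1 *
          (((2 * t.2.1 - 1).doubleFactorial * (2 * t.2.2.1 - 1).doubleFactorial * (2 * t.2.2.2 - 1).doubleFactorial : ℝ) *
            (Real.pi * Real.sqrt Real.pi / (8 ^ (t.2.1 + t.2.2.1 + t.2.2.2) * 8)))).sum -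
        ((2 * Real.pi) ^ 2)⁻¹ * ((Real.pi / 2) ^ 3 * (Mfour.map fun t => t.1 *
          (((2 * t.2.1 - 1).doubleFactorial * (2 * t.2.2.1 - 1).doubleFactorial * (2 * t.2.2.2 - 1).doubleFactorial : ℝ) *
            (2 / ((2 * (t.2.1 + t.2.2.1 + t.2.2.2 : ℕ) + 1) * 2 ^ (t.2.1 + t.2.2.1 + t.2.2.2))) *
              (Real.sqrt Real.pi / Real.pi ^ (2 * (t.2.1 + t.2.2.1 + t.2.2.2))))).sum)) := by
  -- the test field as a Schwartz map
  rw [← coe_pgvS 2 two_pos Q]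
  -- `B(v,v) = -½ P W`, then Leray duality with the two explicit divergences
  rw [integral_inner_eulerBilinear_eq (pgvS 2 (WP P)) (pgvS 2 Q) (fun x => by rw [pgvS_apply 2 two_pos, pgv_WP_eq]),
    integral_inner_lerayProjFun_eq_sub (pgvS 2 (WP P)) (pgvS 2 Q) (pgC 2 (rhoWP P)) (pgC 2 (∑ i, dg 2 i (Q i)))
      (rho_eq (WP P)) (rho_eq Q)]
  -- the Fourier side as a real Gaussian Riesz integral
  have hW' := fourier_pgC_hermiteList (rhoWP P) LW hW
  have hG' := fourier_pgC_hermiteList (∑ i, dg 2 i (Q i)) LG hG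
  rw [re_integral_fourier_pair (rhoWP P) (∑ i, dg 2 i (Q i)) (hermVal LW) (hermVal LG) hW' hG']
  congr 2
  · -- the local integral
    have h1 : (fun x => ⟪(pgvS 2 (WP P)) x, (pgvS 2 Q) x⟫) = fun x => polyE Mloc x * Real.exp (-4 * ‖x‖ ^ 2) := by
      funext x
      rw [pgvS_apply 2 two_pos, pgvS_apply 2 two_pos, inner_pgv_two_pgv_two, pg_def, hloc x]
      norm_num
    rw [show (∫ x, ⟪(pgvS 2 (WP P)) x, (pgvS 2 Q) x⟫) = ∫ x, polyE Mloc x * Real.exp (-4 * ‖x‖ ^ 2) from by rw [← h1],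
      integral_polyE_mul _ integrable_monomial_gauss_four]
    congr 1
    refine List.map_congr_left fun t _ => ?_
    rw [integral_monomial_gauss_four_even]
  · congr 2
    have h2 : (fun ξ : E3 => hermVal LW ξ * hermVal LG ξ * Real.exp (-π ^ 2 * ‖ξ‖ ^ 2) / ‖ξ‖ ^ 2) =
        fun ξ => polyE Mfour ξ * (Real.exp (-π ^ 2 * ‖ξ‖ ^ 2) / ‖ξ‖ ^ 2) := by
      funext ξ; rw [hfour ξ]; ring
    rw [h2, integral_polyE_mul _ integrable_monomial_riesz_weight]
    congr 1
    refine List.map_congr_left fun t _ => ?_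
    rw [← integral_monomial_gauss_div_normSq_pi]
    congr 1
    exact integral_congr_ae (Filter.Eventually.of_forall fun ξ => by ring)

end PairingValue
end Summit.NavierStokesRegularity.NavierStokesRegularity.Theorems.OddMorawetz
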